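/-
Copyright (c) 2026 the pub-hodgecm-mathlib formalisation cell (harness21).  Prover seat hodgecm-mathlib-LH4-p19 (g2), req620 Track A «(D-RAM) FOUR-FRAME» squad
(STAGE-1b, row (2) of the piece `f_{T₊}`, the (β₂) road (R-36) «PURE-CELL LEDGER»; β₂ sub-dealer LH4-p04 lineage, lane B (RamK), row (L-D♭) «the diagonal cell below the
clean line» — the COUNT, invariance of the cell coordinates), 2026-09-04.
-/
import Summits.HodgeConjecture.HodgeConjecture.Theorems.F0P3cDyRamDiagonalCellLetter        -- ★ p861637+p861725 (LH4-p19 (g0)) §4 `v_add_map_le_varpi_pow_mstar_of_datum`, §1 `v_add_map_le_of_le`; brings ★ DEFS `IsOrd`, ★ T4 `mem_order_iff_exists`, `mstarOfRecord`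
import Literature.NumberTheory.LocalFields.QuadraticOrderIntegralBasis                     -- ★ T4 `mem_order_iff_exists` (`z ∈ 𝒪_E + c·𝒪_M ⟺ z = a + c·y`)
import HarnessLib

/-!
# Crux `H413`, line LH4 «(D-RAM) FOUR-FRAME» — STAGE-1b, row (2), the (β₂) road (R-36), lane B, row (L-D♭), THE COUNT — «THE (T, V)-COORDINATES OF A DIAGONAL-CELL LATTICE DO
# NOT DEPEND ON THE GENERATOR, AND MOVE RIGIDLY UNDER A FLIP»: the `Θ`-norm of a unit of the order `𝒪_b = 𝒪_E + ϖE^b𝒪_M` is a doubly fixed `E`-norm times `1 + O(ϖE^{m*})`, and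
# multiplying `ŵ = T·ŵ(V)` by `n·(1 + θ)` (`n ∈ F`, `|θ| ≤ r`) moves `T` to `n·T·(1 + O(r))` and `V` by at most `r`

Cell `hodgecm-mathlib` (D-0151), FLOOR 0, crux item H413 = `stmt-HodgeConjecture-24833`, route of record `HCCMUnconditional`; squad F0∕P3c∕LH4; lane
`--supports stmt-HodgeConjecture-24833 --as helper` (count-neutral; pays NO tier-0 row).  THEOREMS ONLY (no `def`, no instance, no notation, no `sorry`, default heartbeats);
★-only imports; states NO law; (β₂) stays a HYPOTHESIS.  DATUM-FREE one-field RamK letters (`M` with `ρ`, `Θ`, `α`; the ramified datum `IsRamifiedQuadraticDatum Θ ϖE d t` only for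
the trace ideal); no lattice type, no residue field.

WHY (this seat's ★-cand K3 `F0P3cDyRamDiagonalCellCoordinates`: a lattice `Λ = x₀·𝒪_b ∈ D` is read through `ŵ(x₀) = (ν·h·N_Θ x₀)⁻¹ = T·ŵ(V)`; the COUNT (K6) partitions `D` by
the class of `T` and the digit of `V`, and compares fibres by the flip `x₀ ↦ e·x₀`, `N_Θ e = ŵ(V₁)∕ŵ(V₂)`).  Two facts are needed: (i) another generator `x₀′ = x₀·z` of the SAME
lattice (`z ∈ 𝒪_bˣ`) changes `ŵ` by `N_Θ(z)⁻¹`, and `N_Θ(z) = n₀ + τ` with `n₀ = N_Θ(a)` for a `ρ`-FIXED unit `a` (an `E`-norm) and `|τ| ≤ |ϖE|^{m*}` (★ T4 `mem_order_iff_exists`: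
`z = a + ϖE^b·y`; the cross term is a `Θ`-trace of `𝔭^b`, ★ p861725 `v_add_map_le_varpi_pow_mstar_of_datum`; `2b ≥ m*`) — so the class of `T` and the digit of `V` are
invariants of `Λ`; (ii) multiplying `T·ŵ(V)` by `n·(1 + θ)` gives `T′ = n·T·(1 + Tr-small)` and `|V′ − V_target| ≤ |θ|` — used both for (i) and for the flip.
* §1 `exists_isOrd_mul_of_presentations` — two generators of one order lattice differ by a unit of the order.
* §2 `normTheta_orderUnit_eq` — `z ∈ 𝒪_bˣ` ⇒ `zΘz = aΘa + τ`, `ρa = a`, `|a| = 1`, `Θτ = τ`, `|τ| ≤ |ϖE|^{m*}` (`d ≤ b`, `m* ≤ 2b`).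
* §3 `trace_mul_one_add`, `v_trace_mul_one_add_sub_le`, `v_ratio_mul_one_add_sub_le` — THE RIGIDITY LEMMA: for `w₀` with `|w₀| ≤ 1`, `Tr_ρ w₀ = T₀` a unit, `W₀ = Tr_ρ(θ₀w₀)`,
  a `ρ`-fixed `n` and `|θ| ≤ r < 1`: `Tr_ρ(n·w₀(1 + θ)) = n·(T₀ + Tr_ρ(w₀θ))` with `|Tr_ρ(w₀θ)| ≤ r`, and the ratio `W′∕T′` of `n·w₀·(1 + θ)` satisfies `|W′∕T′ − W₀∕T₀| ≤ r`.
* §4 `one_add_of_inv_add` — `(n₀ + τ)⁻¹ = n₀⁻¹·(1 + θ)` with `|θ| ≤ |τ|` (`|n₀| = 1`, `|τ| < 1`), the shape §3 consumes for the generator change.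
WHAT IS NOT CLAIMED: the lattice-level statements (membership of `e•Λ` in `D`, the fibre bijection — K5b) and the assembly (K6).
HONEST LABEL.  Count-neutral local algebra; nothing printed is asserted; no census law is stated; `HC_CM` is proved only modulo the 7 printed citations (2 remaining named inputs:
hLiu418 = `stmt-HodgeConjecture-24832`, h413 = `stmt-HodgeConjecture-24833`) until rung 0 closes.
## References
* [Serre1979] J.-P. Serre, *Local Fields*, GTM 67 (1979): Ch. III §6 Prop. 12 (orders `𝒪_E + c𝒪_M`), Ch. III §3 Prop. 7 (trace ideals), Ch. V §2 Prop. 3.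
* [Jacobowitz1962] R. Jacobowitz, *Hermitian forms over local fields*, Amer. J. Math. 84 (1962): §4.
* [Flicker1998UnitaryFL] Y. Z. Flicker, *Elementary proof of the fundamental lemma for a unitary group*, Canad. J. Math. 50 (1998): p. 84 REMARK (Mars' orders `R + π^jR_E`).
* [Kottwitz1986BaseChangeUnits] R. E. Kottwitz, *Base change for unit elements of Hecke algebras*, Compositio Math. 60 (1986): §1 pp. 240–241.
-/

set_option autoImplicit false

noncomputable section

namespace Summit.HodgeConjecture.HodgeConjecture.Cruxes.H413.F0P3cDyRamDiagonalCellGeneratorChange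

open scoped Valued WithZero
open WithZero
open Literature.NumberTheory.Automorphic.UnitaryThreeFourFrame (IsRamifiedQuadraticDatum)
open Literature.NumberTheory.LocalFields.QuadraticOrder (mem_order_iff_exists)
open Summit.HodgeConjecture.HodgeConjecture.Cruxes.H413.F0P3cDyRamToricCensusDefs
open Summit.HodgeConjecture.HodgeConjecture.Cruxes.H413.F0P3cDyRamFourFramePieces (mstarOfRecord)
open Summit.HodgeConjecture.HodgeConjecture.Cruxes.H413.F0P3cDyRamDiagonalCellLetter (v_add_map_le_of_le v_add_map_le_varpi_pow_mstar_of_datum)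

variable {K : Type} [Field K] [Valued K ℤᵐ⁰] {ρ Θ : K →+* K} {α : K}

/-! ## §1 Two generators of one order lattice differ by a unit of the order -/

/-- **GENERATORS DIFFER BY A UNIT OF THE ORDER**: if `x₀` and `x₀′` both present `Λ` as `x·{ζ ∣ IsOrd ρ α cc ζ}` then `x₀′ = x₀·z`, `x₀ = x₀′·z′` with `IsOrd z`, `IsOrd z′`, `z·z′ = 1`
(`cc(α − ρα)` arbitrary; `1` lies in every order). [cite: Serre1979, Ch. III §6 Prop. 12] [cite: Flicker1998UnitaryFL, p. 84 REMARK] -/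
theorem exists_isOrd_mul_of_presentations {cc x₀ x₀' : K} {Λ : AddSubgroup K} (hx₀ : x₀ ≠ 0)
    (hΛx : ∀ x, x ∈ Λ ↔ ∃ ζ, IsOrd ρ α cc ζ ∧ x = x₀ * ζ) (hΛx' : ∀ x, x ∈ Λ ↔ ∃ ζ, IsOrd ρ α cc ζ ∧ x = x₀' * ζ) :
    ∃ z z' : K, IsOrd ρ α cc z ∧ IsOrd ρ α cc z' ∧ x₀' = x₀ * z ∧ z * z' = 1 := by
  have h1 : IsOrd ρ α cc (1 : K) := by
    rw [isOrd_iff]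
    exact ⟨by rw [Valuation.map_one], by rw [map_one, sub_self, Valuation.map_zero]; exact zero_le⟩
  obtain ⟨z, hz, hx₀'⟩ := (hΛx x₀').1 ((hΛx' x₀').2 ⟨1, h1, (mul_one _).symm⟩)
  obtain ⟨z', hz', hx₀z⟩ := (hΛx' x₀).1 ((hΛx x₀).2 ⟨1, h1, (mul_one _).symm⟩)
  refine ⟨z, z', hz, hz', hx₀', ?_⟩
  have e : x₀ * (z * z') = x₀ * 1 := by rw [← mul_assoc, ← hx₀', ← hx₀z, mul_one]
  exact mul_left_cancel₀ hx₀ e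

/-! ## §2 The `Θ`-norm of a unit of the order `𝒪_b` is a fixed `E`-norm up to `𝔭^{m*}` -/

/-- **`N_Θ(z) = N_Θ(a) + τ` FOR A UNIT `z` OF THE ORDER `𝒪_E + ϖE^b𝒪_M`.**  One-field letters: `ρ` an involution with integral power basis (`hα hα1 hint`), `Θ` with the ramified datum
`IsRamifiedQuadraticDatum Θ ϖE d t`, `Θ ∘ ρ = ρ ∘ Θ`, `ρϖE = ϖE`; `IsOrd ρ α (ϖE^b) z` with `|z| = 1`, `d ≤ b`, `m* ≤ 2b`.  THEN `z = a + ϖE^b·y` (★ T4 `mem_order_iff_exists`) with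
`ρa = a`, `|a| = 1`, and `zΘz = aΘa + τ`, `Θτ = τ`, `|τ| ≤ |ϖE|^{m*}` (the cross term is `Tr_Θ(Θa·ϖE^b y)`, ★ `v_add_map_le_varpi_pow_mstar_of_datum`).
[cite: Serre1979, Ch. III §6 Prop. 12] [cite: Serre1979, Ch. III §3 Prop. 7] [cite: Jacobowitz1962, §4] -/
theorem normTheta_orderUnit_eq (hρρ : ∀ x, ρ (ρ x) = x) (hα : ρ α ≠ α) (hα1 : Valued.v α ≤ 1)
    (hint : ∀ z : K, Valued.v z ≤ 1 → Valued.v ((z - ρ z) / (α - ρ α)) ≤ 1)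
    {ϖE : K} {d t : ℕ} (hD : IsRamifiedQuadraticDatum Θ ϖE d t) (hρϖ : ρ ϖE = ϖE)
    {b : ℕ} (hdb : d ≤ b) (hmb : mstarOfRecord d ≤ 2 * b) {z : K} (hz : IsOrd ρ α (ϖE ^ b) z) (hz1 : Valued.v z = 1) :
    ∃ a τ : K, ρ a = a ∧ Valued.v a = 1 ∧ Θ τ = τ ∧ Valued.v τ ≤ Valued.v ϖE ^ mstarOfRecord d ∧ z * Θ z = a * Θ a + τ := by
  obtain ⟨hΘΘ, hvΘ, hϖ, hfix, hdd, hd1, ht⟩ := hD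
  have hvϖ0 : Valued.v ϖE ≠ 0 := by rw [hϖ]; exact exp_ne_zero
  have hϖ0 : ϖE ≠ 0 := fun h0 => by rw [h0, map_zero] at hvϖ0; exact hvϖ0 rfl
  have hϖ1 : Valued.v ϖE ≤ 1 := by rw [hϖ, ← exp_zero, exp_le_exp]; norm_num
  have hϖlt : Valued.v ϖE < 1 := by rw [hϖ, ← exp_zero, exp_lt_exp]; norm_num
  have hb1 : 1 ≤ b := le_trans hd1 hdb
  obtain ⟨a, y, hρa, ha1, hy1, hzay⟩ := (mem_order_iff_exists hρρ hα hα1 hint (c := ϖE ^ b) (by rw [map_pow, hρϖ]) (pow_ne_zero _ hϖ0)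
    (by rw [Valuation.map_pow]; exact pow_le_one' hϖ1 _) z).1 hz
  -- `|a| = 1`
  have hsmall : Valued.v (ϖE ^ b * y) < 1 := by
    rw [Valuation.map_mul, Valuation.map_pow]
    calc Valued.v ϖE ^ b * Valued.v y ≤ Valued.v ϖE ^ b * 1 := by gcongr
      _ < 1 := by rw [mul_one]; exact pow_lt_one₀ zero_le hϖlt (by omega)
  have ha : Valued.v a = 1 := by
    have e : a = z + -(ϖE ^ b * y) := by rw [hzay]; ring
    have hlt : Valued.v (-(ϖE ^ b * y)) < Valued.v z := by rw [Valuation.map_neg, hz1]; exact hsmall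
    rw [e, Valuation.map_add_eq_of_lt_left _ hlt, hz1]
  refine ⟨a, (a * Θ (ϖE ^ b * y) + Θ (a * Θ (ϖE ^ b * y))) + (ϖE ^ b * y) * Θ (ϖE ^ b * y), hρa, ha, ?_, ?_, ?_⟩
  · simp only [map_add, map_mul, hΘΘ]; ring
  · refine (Valuation.map_add _ _ _).trans (max_le ?_ ?_)
    · -- the cross term: a `Θ`-trace of an element of `𝔭^b`
      refine v_add_map_le_varpi_pow_mstar_of_datum ⟨hΘΘ, hvΘ, hϖ, hfix, hdd, hd1, ht⟩ hdb ?_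
      rw [Valuation.map_mul, hvΘ, ha, one_mul, Valuation.map_mul, Valuation.map_pow]
      calc Valued.v ϖE ^ b * Valued.v y ≤ Valued.v ϖE ^ b * 1 := by gcongr
        _ = _ := mul_one _
    · rw [Valuation.map_mul, hvΘ, Valuation.map_mul, Valuation.map_pow]
      calc Valued.v ϖE ^ b * Valued.v y * (Valued.v ϖE ^ b * Valued.v y) ≤ Valued.v ϖE ^ b * 1 * (Valued.v ϖE ^ b * 1) := by gcongr
        _ = Valued.v ϖE ^ (2 * b) := by simp only [mul_one]; rw [← pow_add, two_mul]
        _ ≤ Valued.v ϖE ^ mstarOfRecord d := pow_le_pow_right_of_le_one' hϖ1 hmb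
  · rw [hzay]; simp only [map_add, map_mul, hΘΘ]; ring

/-! ## §3 THE RIGIDITY LEMMA: `n·w₀·(1 + θ)` has `T′ = n(T₀ + O(θ))` and `|W′∕T′ − W₀∕T₀| ≤ |θ|` -/

omit [Valued K ℤᵐ⁰] in
/-- **`Tr_ρ(n·w₀·(1 + θ)) = n·(Tr_ρ w₀ + Tr_ρ(w₀θ))`** and **`Tr_ρ(θ₀·n·w₀·(1 + θ)) = n·(Tr_ρ(θ₀w₀) + Tr_ρ(θ₀w₀θ))`** for `ρ`-fixed `n`. [cite: Serre1979, Ch. V §2 Prop. 3] -/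
theorem trace_mul_one_add {n w₀ θ θ₀ : K} (hρn : ρ n = n) :
    n * w₀ * (1 + θ) + ρ (n * w₀ * (1 + θ)) = n * ((w₀ + ρ w₀) + (w₀ * θ + ρ (w₀ * θ))) ∧
      θ₀ * (n * w₀ * (1 + θ)) + ρ (θ₀ * (n * w₀ * (1 + θ))) = n * ((θ₀ * w₀ + ρ (θ₀ * w₀)) + (θ₀ * w₀ * θ + ρ (θ₀ * w₀ * θ))) := by
  refine ⟨?_, ?_⟩
  · simp only [map_mul, map_add, map_one, hρn]; ring
  · simp only [map_mul, map_add, map_one, hρn]; ring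

/-- **THE RIGIDITY LEMMA.**  `ρ` isometric, `|θ₀| ≤ 1`, `|w₀| ≤ 1` with `T₀ = w₀ + ρw₀` a UNIT, `W₀ = θ₀w₀ + ρ(θ₀w₀)`, `|θ| ≤ r < 1`, `n` a `ρ`-fixed unit, `w′ = n·w₀·(1 + θ)`,
`T′ = w′ + ρw′`, `W′ = θ₀w′ + ρ(θ₀w′)`.  THEN `|T′∕(n·T₀) − 1| ≤ r`, `|T′| = 1`, and `|W′∕T′ − W₀∕T₀| ≤ r` — the class-and-digit invariants move rigidly.
[cite: Serre1979, Ch. V §2 Prop. 3] [cite: Kottwitz1986BaseChangeUnits, §1 pp. 240–241] -/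
theorem v_coords_mul_one_add (hvρ : ∀ x, Valued.v (ρ x) = Valued.v x) {n w₀ θ θ₀ : K} (hρn : ρ n = n) (hn1 : Valued.v n = 1) (hθ₀ : Valued.v θ₀ ≤ 1)
    (hw₀ : Valued.v w₀ ≤ 1) (hT₀ : Valued.v (w₀ + ρ w₀) = 1) {r : ℤᵐ⁰} (hr : r < 1) (hθ : Valued.v θ ≤ r) :
    Valued.v ((n * w₀ * (1 + θ) + ρ (n * w₀ * (1 + θ))) / (n * (w₀ + ρ w₀)) - 1) ≤ r ∧
      Valued.v (n * w₀ * (1 + θ) + ρ (n * w₀ * (1 + θ))) = 1 ∧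
      Valued.v ((θ₀ * (n * w₀ * (1 + θ)) + ρ (θ₀ * (n * w₀ * (1 + θ)))) / (n * w₀ * (1 + θ) + ρ (n * w₀ * (1 + θ))) -
        (θ₀ * w₀ + ρ (θ₀ * w₀)) / (w₀ + ρ w₀)) ≤ r := by
  obtain ⟨hT', hW'⟩ := trace_mul_one_add (w₀ := w₀) (θ := θ) (θ₀ := θ₀) hρn
  have hn0 : n ≠ 0 := fun h0 => by rw [h0, map_zero] at hn1; exact zero_ne_one hn1
  have hT₀0 : w₀ + ρ w₀ ≠ 0 := fun h0 => by rw [h0, map_zero] at hT₀; exact zero_ne_one hT₀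
  set T₀ : K := w₀ + ρ w₀ with hT₀def
  set W₀ : K := θ₀ * w₀ + ρ (θ₀ * w₀) with hW₀def
  set τT : K := w₀ * θ + ρ (w₀ * θ) with hτT
  set τW : K := θ₀ * w₀ * θ + ρ (θ₀ * w₀ * θ) with hτW
  have hτTv : Valued.v τT ≤ r := by
    refine v_add_map_le_of_le ρ hvρ ?_
    rw [Valuation.map_mul]
    calc Valued.v w₀ * Valued.v θ ≤ 1 * r := by gcongr
      _ = r := one_mul r
  have hτWv : Valued.v τW ≤ r := by
    refine v_add_map_le_of_le ρ hvρ ?_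
    rw [Valuation.map_mul, Valuation.map_mul]
    calc Valued.v θ₀ * Valued.v w₀ * Valued.v θ ≤ 1 * 1 * r := by gcongr
      _ = r := by rw [one_mul, one_mul]
  have hW₀v : Valued.v W₀ ≤ 1 := by
    refine v_add_map_le_of_le ρ hvρ ?_
    rw [Valuation.map_mul]; exact mul_le_one' hθ₀ hw₀
  have hsum1 : Valued.v (T₀ + τT) = 1 := by
    rw [Valuation.map_add_eq_of_lt_left _ (by rw [hT₀]; exact lt_of_le_of_lt hτTv hr), hT₀]
  have hsum0 : T₀ + τT ≠ 0 := fun h0 => by rw [h0, map_zero] at hsum1; exact zero_ne_one hsum1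
  rw [hT', hW']
  refine ⟨?_, by rw [Valuation.map_mul, hn1, one_mul, hsum1], ?_⟩
  · have e : n * (T₀ + τT) / (n * T₀) - 1 = τT / T₀ := by field_simp; ring
    rw [e, map_div₀, hT₀, div_one]; exact hτTv
  · have e : n * (W₀ + τW) / (n * (T₀ + τT)) - W₀ / T₀ = (τW * T₀ - W₀ * τT) / ((T₀ + τT) * T₀) := by field_simp; ring
    rw [e, map_div₀, Valuation.map_mul, hsum1, hT₀, one_mul, div_one]
    refine (Valuation.map_sub _ _ _).trans (max_le ?_ ?_)
    · rw [Valuation.map_mul, hT₀, mul_one]; exact hτWv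
    · rw [Valuation.map_mul]
      calc Valued.v W₀ * Valued.v τT ≤ 1 * r := by gcongr
        _ = r := one_mul r

/-! ## §4 `(n₀ + τ)⁻¹ = n₀⁻¹·(1 + θ)` with `|θ| ≤ |τ|` -/

/-- **INVERTING A NEAR-FIXED UNIT**: for `|n₀| = 1` and `|τ| < 1`, `(n₀ + τ)⁻¹ = n₀⁻¹·(1 + θ)` with `θ = −τ∕(n₀ + τ)`, `|θ| = |τ|`; if `Θn₀ = n₀`, `Θτ = τ` then `Θθ = θ`.
[cite: Serre1979, Ch. V §2 Prop. 3] -/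
theorem inv_add_eq_inv_mul_one_add (hvΘ : ∀ x, Valued.v (Θ x) = Valued.v x) {n₀ τ : K} (hn₀ : Valued.v n₀ = 1) (hτ : Valued.v τ < 1) :
    (n₀ + τ)⁻¹ = n₀⁻¹ * (1 + -(τ / (n₀ + τ))) ∧ Valued.v (-(τ / (n₀ + τ))) = Valued.v τ ∧
      (Θ n₀ = n₀ → Θ τ = τ → Θ (-(τ / (n₀ + τ))) = -(τ / (n₀ + τ))) := by
  have hn₀0 : n₀ ≠ 0 := fun h0 => by rw [h0, map_zero] at hn₀; exact zero_ne_one hn₀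
  have hsum : Valued.v (n₀ + τ) = 1 := by rw [Valuation.map_add_eq_of_lt_left _ (by rw [hn₀]; exact hτ), hn₀]
  have hsum0 : n₀ + τ ≠ 0 := fun h0 => by rw [h0, map_zero] at hsum; exact zero_ne_one hsum
  have _ := hvΘ
  refine ⟨by field_simp; ring, by rw [Valuation.map_neg, map_div₀, hsum, div_one], fun hΘn hΘτ => by rw [map_neg, map_div₀, map_add, hΘn, hΘτ]⟩

end Summit.HodgeConjecture.HodgeConjecture.Cruxes.H413.F0P3cDyRamDiagonalCellGeneratorChange

end
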